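import Mathlib
import HarnessLib
import Summits.Langlands.Langlands.Statement
import Summits.Langlands.Langlands.Theorems.BaseFieldAscentReciprocityTRCMTwistMatching
import Summits.Langlands.Langlands.Theorems.BaseFieldAscentReciprocityTRCMStubDescentOfAutomorphy
import Summits.Langlands.Langlands.Theorems.IrreducibilityBySelfDualityReciprocityUpToIrreducibilityCorrespondsConj
import Summits.Langlands.Langlands.Theorems.IrreducibilityBySelfDualityIrreducibleOffSectorBaseChange
import Literature.NumberTheory.GaloisRepresentations.CliffordTwistOfRestriction

/-!
# Twist matching after cyclic descent of prime degree (crux stmt-Langlands-1094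
# `AscentConjugationSolvable`, line `registered`, stub `primeTwistMatchingOfCyclicDescent`)

The automorphic half of direction (B) of the DOWN-step along a Galois layer `E/F` of prime degree,
in the case where `ρ|_{Γ_E}` is irreducible — the prime-degree generalisation of the quadratic
template `ReciprocityTRCM.stub_twistMatchingOfQuadraticDescent`
(`BaseFieldAscentReciprocityTRCMTwistMatching`).  Setting: `R` reciprocity data over `F` carrying
direction (A) in rank `n` (`AutomorphicToGalois n R hF`), `ρ : Γ_F → GL_n(ℚ̄_ℓ)` with `ρ|_{Γ_E}`
irreducible, a cuspidal `P` on `GL_n(𝔸_E)` Satake–Frobenius compatible with `ρ|_{Γ_E}` almost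
everywhere, and an L-algebraic cuspidal `π₁` on `GL_n(𝔸_F)` of which `P` is a weak base change
(`IsWeakBaseChangeLiftAE`).  Conclusion: some L-algebraic cuspidal `π` on `GL_n(𝔸_F)` is
Satake–Frobenius compatible with `ρ` itself almost everywhere.

Printed argument (Barnet-Lamb–Gee–Geraghty–Taylor §5; Arthur–Clozel Ch. 3, proof of Thm. 3.1
(p. 172) and Thm. 4.2 (d)), and the tree theorems assembling it — everything below is PROVED, no
named fact is consumed as a hypothesis:

1. (A) over `F` gives `ρ₁ = ρ_{π₁,ι}` with `Corresponds R ι π₁ ρ₁`, and `ρ|_{Γ_E} ≅ ρ₁|_{Γ_E}`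
   (`ReciprocityTRCM.exists_corresponds_and_isConjugate_restrictField`: restriction along the weak
   base change, Chebotarev + Brauer–Nesbitt over `E`); `ρ₁|_{Γ_E}` is irreducible by transfer
   (`IrreducibleOffSector.isIrreducible_of_satakeFrobCompatible`).
2. Clifford theory along the normal subgroup `Γ_E ◁ Γ_F`
   (`FramedGaloisRep.exists_twist_of_conj_restrictField`): `g ρ g⁻¹ = ρ₁ ⊗ χ` for a continuous
   character `χ : Γ_F → ℚ̄_ℓˣ` trivial on `Γ_E`; in particular `ker χ ⊇ Γ_E` is open.
3. The complex avatar `ψ = ι ∘ χ⁻¹ : Γ_F → GL_1(ℂ)` is a rank-one Artin representation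
   (`exists_framedArtinRep_inv`: continuity from the open kernel), unramified almost everywhere
   (`FramedGaloisRep.eventually_isUnramifiedAt_of_isOpen_ker`); Artin reciprocity for linear
   characters, a THEOREM of the tree (`artinReciprocity_character_holds`), gives a finite-order
   Hecke character `ω` with `ω(ϖ_v) = ψ(Frob_v) = ι(χ(Frob_v)⁻¹)` wherever `ψ` is unramified.
4. `π := π₁ ⊗ (ω ∘ det)` (`CuspidalAutomorphicRepData.twist`) is cuspidal and L-algebraic
   (`ReciprocityTRCM.isLAlgebraic_twist`), with Satake parameters `ω(ϖ_v) t_{π₁,v}` a.e.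
   (`AutomorphicRepData.eventually_hasSatakeParamAt_twist`).
5. Normalisations: `SatakeFrobCompatibleAt` asks the ARITHMETIC Frobenius to have roots
   `ι⁻¹(a⁻¹)`, `a ∈ t_{π,v}`; on `ρ₁ ⊗ χ` these become `χ(Frob_v) ι⁻¹(a⁻¹) = ι⁻¹((ω(ϖ_v) a)⁻¹)`,
   the prediction from `t_{π,v} = ω(ϖ_v) t_{π₁,v}` — whence the inverse in `ψ = ι ∘ χ⁻¹`
   (`satakeFrobCompatibleAt_twist_of_const`, `arithFrobPolyOfSatake_one_map_const_mul`); finally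
   compatibility is conjugation invariant (`ReciprocityUpToIrreducibility.satakeFrobCompatibleAt_conj`).

Primality of `[E : F]` enters only through finiteness; the statement is proved for every finite
Galois `E/F` (`exists_isLAlgebraic_satakeFrobCompatibleAt_of_galoisDescent`).

References: T. Barnet-Lamb, T. Gee, D. Geraghty, R. Taylor, *Potential automorphy and change of
weight*, Ann. of Math. 179 (2014), §5; J. Arthur, L. Clozel, Ann. of Math. Stud. 120 (1989), Ch. 3,
proof of Thm. 3.1 (p. 172) and Thm. 4.2 (d); A. H. Clifford, Ann. of Math. 38 (1937), §§2–3;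
J. Tate, Cassels–Fröhlich Ch. VII §4.2, §5.1.
-/

noncomputable section

set_option linter.dupNamespace false -- project-wide option; Summit.Langlands.Langlands is the mandated namespace

open scoped MatrixGroups NumberField Classical Polynomial Matrix
open Filter IsDedekindDomain Field Polynomial
open Literature.NumberTheory.Automorphic Literature.NumberTheory.GaloisRepresentations
open Summit.Langlands

namespace Summit.Langlands.Langlands.Theorems.SmithKummerSeedCyclicPrimeDescent

/-! ## The complex avatar of an `ℓ`-adic character with open kernel -/

section ArtinAvatar

variable {F : Type} [Field F] {ℓ : ℕ} [Fact ℓ.Prime]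

/-- **The Artin avatar `ι ∘ χ⁻¹` of an `ℓ`-adic character with open kernel.** For a continuous
character `χ : Γ_F → ℚ̄_ℓˣ` whose kernel is open (equivalently: `χ` has finite image) and a field
isomorphism `ι : ℚ̄_ℓ ≃ ℂ`, the homomorphism `σ ↦ ι(χ(σ)⁻¹)`, framed in `GL_1(ℂ)`, is a rank-one
Artin representation `ψ` of `F` (continuous because its kernel, that of `χ`, is open) with
`ψ(σ)₀₀ = ι(χ(σ)⁻¹)`. [folklore] -/
theorem exists_framedArtinRep_inv (ι : PadicAlgCl ℓ ≃+* ℂ)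
    (χ : absoluteGaloisGroup F →ₜ* (PadicAlgCl ℓ)ˣ)
    (hχ : IsOpen (χ.toMonoidHom.ker : Set (absoluteGaloisGroup F))) :
    ∃ ψ : FramedArtinRep F 1, (∀ σ, ψ σ = 1 ↔ χ σ = 1) ∧
      ∀ σ, ((ψ σ : GL (Fin 1) ℂ) : Matrix (Fin 1) (Fin 1) ℂ) 0 0 =
        ι (((χ σ)⁻¹ : (PadicAlgCl ℓ)ˣ) : PadicAlgCl ℓ) := by
  -- the bare homomorphism `σ ↦ ι (χ σ)⁻¹ : Γ_F →* ℂˣ`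
  let f : absoluteGaloisGroup F →* ℂˣ :=
    (Units.map (ι : PadicAlgCl ℓ →+* ℂ).toMonoidHom).comp (invMonoidHom.comp χ.toMonoidHom)
  have hf : ∀ σ, (f σ : ℂ) = ι (((χ σ)⁻¹ : (PadicAlgCl ℓ)ˣ) : PadicAlgCl ℓ) := fun σ => rfl
  have hfker : ∀ σ, f σ = 1 ↔ χ σ = 1 := fun σ => by
    rw [← Units.val_eq_one, hf, EmbeddingLike.map_eq_one_iff, Units.val_eq_one, inv_eq_one]
  have hfopen : IsOpen (f.ker : Set (absoluteGaloisGroup F)) := by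
    refine Subgroup.isOpen_mono (fun σ hσ => ?_) hχ
    rw [MonoidHom.mem_ker] at hσ ⊢
    exact (hfker σ).mpr hσ
  let f' : absoluteGaloisGroup F →ₜ* ℂˣ := ⟨f, MonoidHom.continuous_of_isOpen_ker f hfopen⟩
  refine ⟨ContinuousMonoidHom.comp
      (FramedRep.unitsContinuousMulEquivOfUnique (Fin 1) ℂ : ℂˣ →ₜ* GL (Fin 1) ℂ) f',
    fun σ => ?_, fun σ => ?_⟩
  · rw [← hfker σ]
    exact EmbeddingLike.map_eq_one_iff (f := FramedRep.unitsContinuousMulEquivOfUnique (Fin 1) ℂ)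
  · exact hf σ

end ArtinAvatar

/-! ## Satake–Frobenius bookkeeping of a twist by a root of unity (L-normalisation `m = 1`) -/

section Bookkeeping

variable {ℓ : ℕ} [Fact ℓ.Prime]

/-- **Rescaling the Satake parameter by `c` rescales the predicted arithmetic-Frobenius roots by
`ι⁻¹(c⁻¹)`**: the roots of `arithFrobPolyOfSatake ι q 1 (c · α)` are `ι⁻¹(c⁻¹) · ι⁻¹(a⁻¹)`,
`a ∈ α` (`(c a)⁻¹ = c⁻¹ a⁻¹`). [folklore] -/
theorem arithFrobPolyOfSatake_one_map_const_mul (ι : PadicAlgCl ℓ ≃+* ℂ) (q : ℕ)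
    (α : Multiset ℂ) (c : ℂ) :
    arithFrobPolyOfSatake ι q 1 (α.map (c * ·)) =
      ((α.map fun a => ι.symm a⁻¹).map fun b => X - C (ι.symm c⁻¹ * b)).prod := by
  rw [arithFrobPolyOfSatake_one, Multiset.map_map, Multiset.map_map]
  congr 1
  refine Multiset.map_congr rfl fun a _ => ?_
  simp only [Function.comp_apply, mul_inv, map_mul]

end Bookkeeping

/-! ## Compatibility of the twisted pair `(π₁ ⊗ (ω ∘ det), ρ₁ ⊗ χ)` at a good place -/

section TwistCompat

variable {F : Type} [Field F] [NumberField F] {n : ℕ} {hF : isCompact_glFiniteIntegralLevel n F}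
  {ℓ : ℕ} [Fact ℓ.Prime]

/-- **The twisted pair is Satake–Frobenius compatible at a good place** (Arthur–Clozel Ch. 3,
p. 172: `t_{π ⊗ η,v} = η(ϖ_v) t_{π,v}`). At a place `v`: if `π` and `ρ` are compatible at `v`
(summit predicate, L-normalisation: the arithmetic Frobenius has roots `ι⁻¹(a⁻¹)`, `a ∈ t_{π,v}`),
`π'` has Satake parameter `c · α` for every Satake parameter `α` of `π` at `v`, and the `ℓ`-adic
character `χ` is trivial on the inertia groups above `v` with constant value `ι⁻¹(c⁻¹)` on the
arithmetic Frobenii above `v`, then `π'` and `ρ ⊗ χ` are compatible at `v`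
(`FramedGaloisRep.isUnramifiedAt_twist`, `FramedGaloisRep.hasFrobCharpolyAt_twist_of_eq_prod`).
[cite: ArthurClozelAMS120, Ch. 3, proof of Thm. 3.1 (p. 172)] -/
theorem satakeFrobCompatibleAt_twist_of_const (ι : PadicAlgCl ℓ ≃+* ℂ)
    {π π' : AutomorphicRepData (AutomorphyDatum.gl n F hF)}
    {ρ : FramedGaloisRep F (PadicAlgCl ℓ) n} {χ : absoluteGaloisGroup F →ₜ* (PadicAlgCl ℓ)ˣ}
    {v : HeightOneSpectrum (𝓞 F)} {c : ℂ}
    (hχI : ∀ 𝔓 ∈ v.primesAbove, ∀ σ ∈ 𝔓.inertia (absoluteGaloisGroup F), χ σ = 1)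
    (hχF : ∀ 𝔓 ∈ v.primesAbove, ∀ σ : absoluteGaloisGroup F, IsArithFrobAt (𝓞 F) σ 𝔓 →
      ((χ σ : (PadicAlgCl ℓ)ˣ) : PadicAlgCl ℓ) = ι.symm c⁻¹)
    (htw : ∀ α : Multiset ℂ, π.HasSatakeParamAt v α → π'.HasSatakeParamAt v (α.map (c * ·)))
    (h : SatakeFrobCompatibleAt ι π ρ v) :
    SatakeFrobCompatibleAt ι π' (ρ.twist χ) v := by
  obtain ⟨α, hα, hur, hcp⟩ := h
  refine ⟨α.map (c * ·), htw α hα, FramedGaloisRep.isUnramifiedAt_twist hur hχI, ?_⟩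
  rw [arithFrobPolyOfSatake_one_map_const_mul]
  rw [ReciprocityTRCM.arithFrobPolyOfSatake_one_eq_prod_map] at hcp
  exact FramedGaloisRep.hasFrobCharpolyAt_twist_of_eq_prod hcp hχF

end TwistCompat

/-! ## Assembly: twist matching after cyclic descent of prime degree -/

section Main

variable {F E : Type} [Field F] [NumberField F] [Field E] [NumberField E] [Algebra F E]
  {n : ℕ} {hF : isCompact_glFiniteIntegralLevel n F} {hE : isCompact_glFiniteIntegralLevel n E}
  {ℓ : ℕ} [Fact ℓ.Prime]

/-- **Twist matching after descent along a finite Galois layer** (BLGGT §5; Arthur–Clozel Ch. 3,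
proof of Thm. 3.1 and Thm. 4.2 (d)). `E/F` finite Galois, `R` reciprocity data over `F` with
direction (A) in rank `n`, `ρ : Γ_F → GL_n(ℚ̄_ℓ)` with `ρ|_{Γ_E}` irreducible, `P` automorphic on
`GL_n(𝔸_E)` a.e. compatible with `ρ|_{Γ_E}`, and `π₁` cuspidal L-algebraic on `GL_n(𝔸_F)` with
`P` a weak base change of `π₁`. Then some L-algebraic cuspidal `π = π₁ ⊗ (ω ∘ det)` is
Satake–Frobenius compatible with `ρ` almost everywhere: (A) gives `ρ₁ ↔ π₁` with
`ρ|_{Γ_E} ≅ ρ₁|_{Γ_E}` (Chebotarev rigidity over `E`,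
`ReciprocityTRCM.exists_corresponds_and_isConjugate_restrictField`); Clifford theory along the
normal subgroup `Γ_E ◁ Γ_F` (`FramedGaloisRep.exists_twist_of_conj_restrictField`) gives
`ρ ≅ ρ₁ ⊗ χ` with `χ : Γ_F → ℚ̄_ℓˣ` trivial on `Γ_E`, so with open kernel; Artin reciprocity for
the rank-one Artin representation `ι ∘ χ⁻¹` (`artinReciprocity_character_holds`, a theorem of the
tree) provides a finite-order Hecke character `ω` with `ω(ϖ_v) = ι(χ(Frob_v)⁻¹)` a.e.; the twist
`π₁ ⊗ (ω ∘ det)` is cuspidal, L-algebraic (`ReciprocityTRCM.isLAlgebraic_twist`), with Satake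
parameters `ω(ϖ_v) t_{π₁,v}` (`AutomorphicRepData.eventually_hasSatakeParamAt_twist`), matching
`ρ₁ ⊗ χ` (`satakeFrobCompatibleAt_twist_of_const`); compatibility is conjugation invariant.
[cite: BarnetlambEtAl2014, §5] [cite: ArthurClozelAMS120, Ch. 3, proof of Thm. 3.1 (p. 172)] -/
theorem exists_isLAlgebraic_satakeFrobCompatibleAt_of_galoisDescent [IsGalois F E]
    [FiniteDimensional F E] (R : ReciprocityData F) (hA : AutomorphicToGalois n R hF)
    (ι : PadicAlgCl ℓ ≃+* ℂ) (ρ : FramedGaloisRep F (PadicAlgCl ℓ) n)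
    (hirr : (ρ.restrictField E).toGaloisRep.IsIrreducible)
    (P : AutomorphicRepData (AutomorphyDatum.gl n E hE)) (π₁ : CuspidalAutomorphicRepData n F hF)
    (hL : π₁.1.IsLAlgebraic) (hBC : IsWeakBaseChangeLiftAE π₁.1 P)
    (hP : ∀ᶠ w : HeightOneSpectrum (𝓞 E) in cofinite,
      SatakeFrobCompatibleAt ι P (ρ.restrictField E) w) :
    ∃ π : CuspidalAutomorphicRepData n F hF, π.1.IsLAlgebraic ∧
      ∀ᶠ v : HeightOneSpectrum (𝓞 F) in cofinite, SatakeFrobCompatibleAt ι π.1 ρ v := by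
  -- (A) over `F`: `ρ₁ ↔ π₁`, and `ρ|_{Γ_E} ≅ ρ₁|_{Γ_E}` by Chebotarev rigidity over `E`
  obtain ⟨ρ₁, -, -, hcorr₁, hconj⟩ :=
    ReciprocityTRCM.exists_corresponds_and_isConjugate_restrictField R hA π₁ hL P hBC ι ρ hirr hP
  -- `ρ₁|_{Γ_E}` is irreducible (transfer along the common compatibility with `P`)
  have hirr₁E : (ρ₁.restrictField E).IsIrreducible :=
    (FramedRep.isIrreducible_toContinuousRep_iff _).mp
      (IrreducibleOffSector.isIrreducible_of_satakeFrobCompatible P ι hirr hP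
        (IrreducibleOffSector.eventually_satakeFrobCompatibleAt_restrictField ι π₁.1 P hBC ρ₁
          hcorr₁.1))
  -- Clifford theory along `Γ_E ◁ Γ_F`: `g ρ g⁻¹ = ρ₁ ⊗ χ`, `χ` trivial on `Γ_E`
  obtain ⟨χ, g, hχE, hg⟩ := FramedGaloisRep.exists_twist_of_conj_restrictField ρ ρ₁ hirr₁E hconj
  have hρ : ρ = FramedRep.conj g⁻¹ (ρ₁.twist χ) := by
    rw [← hg]
    exact ContinuousMonoidHom.ext fun σ => by simp only [FramedRep.conj_apply, inv_inv]; group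
  -- `χ` has open kernel (it contains the open subgroup `Γ_E`)
  have hker : IsOpen (χ.toMonoidHom.ker : Set (absoluteGaloisGroup F)) := by
    refine Subgroup.isOpen_mono (H₁ := (absGaloisRestrict F E).range) ?_
      (isOpen_range_absGaloisRestrict_and_index F E).1
    rintro _ ⟨σ, rfl⟩
    exact hχE σ
  -- Artin reciprocity for the Artin character `ι ∘ χ⁻¹`
  obtain ⟨ψ, hψker, hψval⟩ := exists_framedArtinRep_inv ι χ hker
  obtain ⟨ω, hωfin, hω⟩ := artinReciprocity_character_holds F ψ
  have hψopen : IsOpen (ψ.toMonoidHom.ker : Set (absoluteGaloisGroup F)) := by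
    have : (ψ.toMonoidHom.ker : Set (absoluteGaloisGroup F)) = χ.toMonoidHom.ker :=
      Set.ext fun σ => hψker σ
    rw [this]
    exact hker
  -- the twist `π₁ ⊗ (ω ∘ det)`
  refine ⟨π₁.twist ω hωfin, ReciprocityTRCM.isLAlgebraic_twist π₁.1 ω hωfin hL, ?_⟩
  rw [hρ, CuspidalAutomorphicRepData.twist_val]
  filter_upwards [hcorr₁.1, π₁.1.eventually_hasSatakeParamAt_twist hωfin,
    ψ.eventually_isUnramifiedAt_of_isOpen_ker hψopen] with v hv htw hψv
  refine ReciprocityUpToIrreducibility.satakeFrobCompatibleAt_conj ι _ g⁻¹ ?_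
  refine satakeFrobCompatibleAt_twist_of_const ι (c := ω.valueAtUniformizer v)
    (fun 𝔓 h𝔓 σ hσ => (hψker σ).mp (hψv 𝔓 h𝔓 σ hσ)) (fun 𝔓 h𝔓 σ hσ => ?_) htw hv
  -- Frobenius dictionary: `ι(χ(Φ)⁻¹) = ψ(Φ)₀₀ = ω(ϖ_v)`
  have e := (FramedGaloisRep.hasFrobCharpolyAt_iff_of_rank_one ψ v _).mp (hω v hψv).2 𝔓 h𝔓 σ hσ
  rw [hψval σ] at e
  have e' : (((χ σ)⁻¹ : (PadicAlgCl ℓ)ˣ) : PadicAlgCl ℓ) = ι.symm (ω.valueAtUniformizer v) := by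
    rw [← e, RingEquiv.symm_apply_apply]
  rw [map_inv₀, ← e', Units.val_inv_eq_inv_val, inv_inv]

end Main

/-! ## Registered sub-goal form (crux stmt-Langlands-1094, line `registered`) -/

/-- **Registered stub `primeTwistMatchingOfCyclicDescent` of line `registered` (crux
stmt-Langlands-1094), verbatim signature**: after L-algebraic cyclic descent `P ↦ π₁` along a
Galois layer `E/F` of prime degree, with (A) over `F` in rank `n`, `ρ|_{Γ_E}` irreducible and a.e.
compatible with the cuspidal `P`, the representation `ρ` itself is weakly automorphic over `F`:
some L-algebraic cuspidal `π = π₁ ⊗ (ω ∘ det)` is Satake–Frobenius compatible with `ρ` almost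
everywhere (`exists_isLAlgebraic_satakeFrobCompatibleAt_of_galoisDescent`; primality of the degree
is not used beyond finiteness). [cite: BarnetlambEtAl2014, §5]
[cite: ArthurClozelAMS120, Ch. 3, proof of Thm. 3.1 (p. 172) and Thm. 4.2 (d)] -/
theorem primeTwistMatchingOfCyclicDescent : ∀ (n : ℕ) (F E : Type) [Field F] [NumberField F] [Field E] [NumberField E] [Algebra F E] [IsGalois F E], (Module.finrank F E).Prime → ∀ (R : Summit.Langlands.ReciprocityData F) (hF : Literature.NumberTheory.Automorphic.isCompact_glFiniteIntegralLevel n F) (hE : Literature.NumberTheory.Automorphic.isCompact_glFiniteIntegralLevel n E), Summit.Langlands.AutomorphicToGalois n R hF → ∀ (ℓ : ℕ) [Fact ℓ.Prime] (ι : PadicAlgCl ℓ ≃+* ℂ) (ρ : Literature.NumberTheory.GaloisRepresentations.FramedGaloisRep F (PadicAlgCl ℓ) n), (ρ.restrictField E).toGaloisRep.IsIrreducible → ∀ (P : Literature.NumberTheory.Automorphic.CuspidalAutomorphicRepData n E hE) (π₁ : Literature.NumberTheory.Automorphic.CuspidalAutomorphicRepData n F hF), π₁.1.IsLAlgebraic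 → Literature.NumberTheory.Automorphic.IsWeakBaseChangeLiftAE π₁.1 P.1 → (∀ᶠ w : IsDedekindDomain.HeightOneSpectrum (NumberField.RingOfIntegers E) in Filter.cofinite, Summit.Langlands.SatakeFrobCompatibleAt ι P.1 (ρ.restrictField E) w) → ∃ π : Literature.NumberTheory.Automorphic.CuspidalAutomorphicRepData n F hF, π.1.IsLAlgebraic ∧ ∀ᶠ v : IsDedekindDomain.HeightOneSpectrum (NumberField.RingOfIntegers F) in Filter.cofinite, Summit.Langlands.SatakeFrobCompatibleAt ι π.1 ρ v := by
  intro n F E _ _ _ _ _ _ hp R hF hE hA ℓ _ ι ρ hirr P π₁ hL hBC hP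
  haveI : FiniteDimensional F E := Module.finite_of_finrank_pos hp.pos
  exact exists_isLAlgebraic_satakeFrobCompatibleAt_of_galoisDescent R hA ι ρ hirr P.1 π₁ hL hBC hP

end Summit.Langlands.Langlands.Theorems.SmithKummerSeedCyclicPrimeDescent

end
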